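import Summits.BirchSwinnertonDyer.BirchSwinnertonDyer.Theses.KatoDescentTamePotSupersingular
import Summits.BirchSwinnertonDyer.BirchSwinnertonDyer.Theorems.KatoDescentPotSupersingularReducibleKatoMemberOfFineInputsCharForm
import HarnessLib

/-!
# Crux M (K8-t′ `ReducibleKatoMember`), its HELD child 27962 `PublishedInputMemberHullZetaCore` and U₀-red's
# `PublishedInputKatoCorePackageU0RedT` BY NAME from {modularity, Fine, H2X⁺, FW} ⊕ THE CHARACTER FORM OF IWASAWA's `μ = 0` —
# NO Lim 2017 Thm. 3.5, NO Imai (route `KatoDescentTamePotSupersingular`; seat `bsd-potss-rkm` g33)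

Typed closers for tenure: the conclusions are the route's declarations BY NAME; the hypotheses are exactly the NAMED Literature facts
{`Kato2004.exists_memberHullZetaFineInputs` (hull sub-package), `Kato2004.exists_iwasawaH2Data_fineSelmerDual_embedding_count` (H2X⁺),
`IwasawaTheory.ferreroWashington1979_classicalMuVanishes`, `IwasawaTheory.classicalMuVanishes_finite_unramifiedClasses` (the character
form of Iwasawa's `μ = 0`: Lang GTM 121 Ch. 5 structure theory ∘ class field theory)} (+ modularity for M).  Compared with the g32 closers
(`FineInputsNoImaiKT.*`) the input `Lim2017.thm35_…` (the `L`-form of Coates–Sujatha 2005 Thm. 3.4, hiding Iwasawa's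
`p`-extension ascent) is GONE: statement (A) on the reducible rows is proved over the abelian Borel field by dévissage
(`ReducibleFineSelmerMuZeroCharForm`, `FineInputsCharForm`, this seat).  CONDITIONAL theorems (the facts stay named; no `_holds` for
Fine / H2X⁺ is expected — Kato's Euler system); they close nothing by themselves; BSD is proved for no curve.

References: [Kato2004Asterisque] Thm. 12.5–12.6 (pp. 221–222), Cor. 14.3, Thm. 14.5 (pp. 235–236), (14.9.1)–(14.9.3) (pp. 239–240),
§14.14 (p. 243), Prop. 14.16 (2) (pp. 244–245); [Wuthrich2014] Lemma 14; [CoatesSujatha2005] Cor. 3.6; [Lang1990] Ch. 5 §§1–4;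
[BreuilConradDiamondTaylor2001] Thm. A.
-/

-- the summit and its single problem are both named `BirchSwinnertonDyer` (registry layout D-0017)
set_option linter.dupNamespace false
set_option autoImplicit false

noncomputable section

open Literature.NumberTheory.EllipticCurves Literature.NumberTheory.EllipticCurves.ModularForms
  Literature.NumberTheory.EllipticCurves.Kato2004 Literature.NumberTheory.IwasawaTheory
open Summit.BirchSwinnertonDyer.BirchSwinnertonDyer.Theorems

namespace Summit.BirchSwinnertonDyer.BirchSwinnertonDyer.Theorems.FineInputsCharFormKT

/-- **The HELD child 27962 `PublishedInputMemberHullZetaCore` BY NAME from the hull sub-package, H2X⁺, the char-form `μ = 0` and FW —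
no Lim, no Imai.** [cite: Kato2004Asterisque, Thm. 12.5 (3) (p. 222), (14.9.1) (p. 239), (14.9.3) (p. 240), §14.14 (14.14.1)–(14.14.2) (p. 243)]
[cite: CoatesSujatha2005, Cor. 3.6] -/
theorem publishedInputMemberHullZetaCore_of_fineInputs_of_charForm (hF : exists_memberHullZetaFineInputs)
    (hH : exists_iwasawaH2Data_fineSelmerDual_embedding_count)
    (hchar : classicalMuVanishes_finite_unramifiedClasses)
    (hFW : ferreroWashington1979_classicalMuVanishes) :
    Summit.BirchSwinnertonDyer.BirchSwinnertonDyer.Theses.KatoDescentTamePotSupersingular.PublishedInputMemberHullZetaCore :=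
  FineInputsCharForm.exists_memberHullZetaCoreInputs_of_fineInputs_of_charForm hF hH hchar hFW

/-- **U₀-red's copy `PublishedInputKatoCorePackageU0RedT` (the same constant) BY NAME from the same facts — no Lim, no Imai.**
[cite: Kato2004Asterisque, §14.14 (14.14.1)–(14.14.2) (p. 243), proof of Prop. 14.16 (2) (pp. 244–245)] [cite: CoatesSujatha2005, Cor. 3.6] -/
theorem publishedInputKatoCorePackageU0RedT_of_fineInputs_of_charForm (hF : exists_memberHullZetaFineInputs)
    (hH : exists_iwasawaH2Data_fineSelmerDual_embedding_count)
    (hchar : classicalMuVanishes_finite_unramifiedClasses)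
    (hFW : ferreroWashington1979_classicalMuVanishes) :
    Summit.BirchSwinnertonDyer.BirchSwinnertonDyer.Theses.KatoDescentTamePotSupersingular.PublishedInputKatoCorePackageU0RedT :=
  FineInputsCharForm.exists_memberHullZetaCoreInputs_of_fineInputs_of_charForm hF hH hchar hFW

/-- **Crux M (`ReducibleKatoMember`) from modularity, the hull sub-package, H2X⁺, the char-form `μ = 0` and FW, Literature-constant
form — no Lim, no Imai, no Gross–Zagier–Kolyvagin, no Poitou–Tate binder, no abstract `𝐇²`.**
[cite: Kato2004Asterisque, Thm. 12.5/12.6 (p. 222), Cor. 14.3, Thm. 14.5 (pp. 235–236), (14.9.1)–(14.9.3) (pp. 239–240), (14.14.1)–(14.14.2) (p. 243), Prop. 14.16 (2) (pp. 244–245)]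
[cite: Wuthrich2014, Lemma 14 (p. 396)] -/
theorem tameReducibleKatoMember_of_newform_of_fineInputs_of_charForm (hmod : exists_isNewformOf)
    (hF : exists_memberHullZetaFineInputs) (hH : exists_iwasawaH2Data_fineSelmerDual_embedding_count)
    (hchar : classicalMuVanishes_finite_unramifiedClasses)
    (hFW : ferreroWashington1979_classicalMuVanishes) :
    Summit.BirchSwinnertonDyer.BirchSwinnertonDyer.Theses.KatoDescentTamePotSupersingular.ReducibleKatoMember :=
  FineInputsCharForm.katoMemberShaBoundOfReducible_of_newform_of_fineInputs_of_charForm hmod hF hH hchar hFW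

/-- **Crux M keyed to the live alias `PublishedInputNewformKatoZ`** (through its modularity conjunct) and the four facts.
[cite: Kato2004Asterisque, Cor. 14.3, Thm. 14.5 (pp. 235–236), Prop. 14.16 (2) (pp. 244–245)] [cite: BreuilConradDiamondTaylor2001, Thm. A] -/
theorem tameReducibleKatoMember_of_newformZ_of_fineInputs_of_charForm
    (hmod : Summit.BirchSwinnertonDyer.BirchSwinnertonDyer.Theses.KatoDescentTamePotSupersingular.PublishedInputNewformKatoZ)
    (hF : exists_memberHullZetaFineInputs) (hH : exists_iwasawaH2Data_fineSelmerDual_embedding_count)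
    (hchar : classicalMuVanishes_finite_unramifiedClasses)
    (hFW : ferreroWashington1979_classicalMuVanishes) :
    Summit.BirchSwinnertonDyer.BirchSwinnertonDyer.Theses.KatoDescentTamePotSupersingular.ReducibleKatoMember :=
  tameReducibleKatoMember_of_newform_of_fineInputs_of_charForm hmod hF hH hchar hFW

/-- **Crux M keyed to U₀-red's live modularity alias `PublishedInputModularityU0RedT`** and the four facts.
[cite: Kato2004Asterisque, Prop. 14.16 (2) (pp. 244–245)] [cite: BreuilConradDiamondTaylor2001, Thm. A] -/
theorem tameReducibleKatoMember_of_modularityU0RedT_of_fineInputs_of_charForm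
    (hmod : Summit.BirchSwinnertonDyer.BirchSwinnertonDyer.Theses.KatoDescentTamePotSupersingular.PublishedInputModularityU0RedT)
    (hF : exists_memberHullZetaFineInputs) (hH : exists_iwasawaH2Data_fineSelmerDual_embedding_count)
    (hchar : classicalMuVanishes_finite_unramifiedClasses)
    (hFW : ferreroWashington1979_classicalMuVanishes) :
    Summit.BirchSwinnertonDyer.BirchSwinnertonDyer.Theses.KatoDescentTamePotSupersingular.ReducibleKatoMember :=
  tameReducibleKatoMember_of_newform_of_fineInputs_of_charForm hmod hF hH hchar hFW

end Summit.BirchSwinnertonDyer.BirchSwinnertonDyer.Theorems.FineInputsCharFormKT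

end
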